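import Literature.AnabelianGeometry.AbsoluteAnabelian.AbsTopIII.KummerDescentLaws
import HarnessLib

/-!
# [AbsTopIII] §1: per-curve LAWS of the model interface, IV — cusps along cofinite opens with COHERENT
# decomposition groups (successor structure `CoherentKummerModel extends DescentKummerModel`)

Mochizuki, *Topics in Absolute Anabelian Geometry III*, §1 (manuscript pages, lit key
`paper:url-5493eb38cbb7`): Prop. 1.4 (i) p. 31 ("Then `U_x` is a hyperbolic curve over `k`; the inertia
group `I_x` of `x` in `Δ_U` is naturally isomorphic to `Ẑ(1)`; the kernels of the natural surjections
`Δ_U ↠ Δ_{U_x}`, `Π_U ↠ Π_{U_x}` are topologically normally generated by the inertia groups of points of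
`U_x ∖ U`"); Thm. 1.9 (b) p. 37 ("`Z` is the canonical compactification of `Y`, the points of `Z ∖ U` are
all rational [...] `z ∈ (Z ∖ U)(k_Z)` — via the technique of Proposition 1.4, (ii)"); [AbsTopII] Cor. 3.7 (c)
as quoted in Thm. 1.9 (a) p. 37 ("the decomposition groups of the closed points of `X` lying in the
complement of `U_X` may be obtained as the images via `Π_{U_X} ↠ Π` of the cuspidal decomposition groups").

Fourth layer of the interface owner's successor structures (abc-iut-L4-t1; `KummerCurveLaws.lean`,
`KummerTowerLaws.lean`, `KummerDescentLaws.lean`).  `NaturalKummerModel` relates the cusps of a cofinite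
open `U ⊆ X` to `X` only UP TO CONJUGACY (`decomp_cuspPt`, `decomp_cuspPt_none`) and has no composition
law for `cuspPt` along `U ⊆ U′ ⊆ X`; abc-iut-w5-d213's presentations `CuspSyncPresentation` ("the third
curves `U ⊆ Z ∖ {z} ⊆ Z`") need the cusp of `Z ∖ {z}` that `z` IS, with its CHOSEN decomposition group equal
to the image of `D_z` ON THE NOSE.  At the intended étale-`π₁` model this holds when every decomposition
group (of a cusp or a closed point, in every open) is chosen as the image of the decomposition group of ONE
chosen place of `K^sep` over the point — a coherent choice the model may make.  `CoherentKummerModel`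
records:

* (C) `cuspRes h c _` — the cusp of `X` that an unfilled cusp `c` of `U` is, with `D_c ↦ D_{cuspRes c}`
  EXACTLY (`decomp_cuspRes`), every cusp of `X` arising so (`exists_cuspRes_eq`); the composition laws of
  `cuspPt` along `U ⊆ U′ ⊆ X` (`cuspPt_comp_some`, `cuspPt_comp_none`);
* (P) for scheme-like curves, decomposition groups of CLOSED POINTS meet `Δ` trivially (`D_y ≅ G_{k(y)}`
  embeds into `G_k`; `decomp_inf_geom`).

With these and the named facts Prop. 1.4 (i)(ii) the presentations of Thm. 1.9 (b) are CONSTRUCTED in the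
companion `Thm19bPresentationsProofs.lean` (abc-iut-L4-t1).  Every field is an INTERFACE LAW (typing policy
θ): TRUE at the intended model with coherent choices; NOT a published prerequisite, NOT a named Prop fact;
no instance is asserted.  HONEST FRAMING: statements-first; typed ≠ proved; nothing here bears on
[IUTchIII] Cor. 3.12.
-/

noncomputable section

open CategoryTheory
open scoped Classical Pointwise

namespace Literature.AnabelianGeometry.AbsoluteAnabelian.AbsTopIII

universe u

/-- **The model interface with coherent cusps** (successor of `DescentKummerModel`; interface owner
abc-iut-L4-t1): a `DescentKummerModel` TOGETHER WITH, along every cofinite open `U ⊆ X`, the cusp of `X`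
underlying each cusp of `U` that fills no point of `X`, with decomposition groups corresponding EXACTLY under
`Π_U ↠ Π_X` (coherent representatives), the composition laws of the filled points along `U ⊆ U′ ⊆ X`, and the
triviality of `D_y ∩ Δ_X` for closed points `y` of a scheme-like `X`.  INTERFACE (typing policy θ); no
instance is asserted. [cite: MochizukiAbsTopIII2015, Prop 1.4 (i) p.31] -/
structure CoherentKummerModel : Type (u + 2) extends DescentKummerModel.{u} where
  /-- (C) the cusp of `X` that a cusp `c` of `U` filling NO point of `X` is (`U ⊆ X` cofinite open have the
  same compactification; "`U_x := X ∖ {x}`", Prop. 1.4 p. 31). -/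
  cuspRes : ∀ {U X : Curve} (h : IsCofiniteOpen U X) (c : (cusps U).Cusp), cuspPt h c = none →
    (cusps X).Cusp
  /-- (C) COHERENT decomposition groups: `D_c ⊆ Π_U` maps EXACTLY onto the chosen decomposition group of
  the same cusp in `Π_X` ("the images via `Π_{U_X} ↠ Π` of the cuspidal decomposition groups", Thm. 1.9 (a)
  p. 37 quoting [AbsTopII] Cor. 3.7 (c); on the nose for the model's coherent choice of representatives). -/
  decomp_cuspRes : ∀ {U X : Curve} (h : IsCofiniteOpen U X) (c : (cusps U).Cusp)
    (hc : cuspPt h c = none),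
    ((cusps U).Dcusp c).map (res h).arith.toMonoidHom = (cusps X).Dcusp (cuspRes h c hc)
  /-- (C) every cusp of `X` is a cusp of `U` (same compactification). -/
  exists_cuspRes_eq : ∀ {U X : Curve} (h : IsCofiniteOpen U X) (c' : (cusps X).Cusp),
    ∃ (c : (cusps U).Cusp) (hc : cuspPt h c = none), cuspRes h c hc = c'
  /-- (C) composition along `U ⊆ U′ ⊆ X`: a cusp of `U` filling the point `x` of `U′` fills the point `x` of
  `X`. -/
  cuspPt_comp_some : ∀ {U U' X : Curve} (h₁ : IsCofiniteOpen U U') (h₂ : IsCofiniteOpen U' X)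
    (h : IsCofiniteOpen U X) (c : (cusps U).Cusp) (x : Point U'),
    cuspPt h₁ c = some x → cuspPt h c = some (ptRes h₂ x)
  /-- (C) composition along `U ⊆ U′ ⊆ X`: a cusp of `U` that stays a cusp of `U′` fills in `X` exactly
  what that cusp of `U′` fills. -/
  cuspPt_comp_none : ∀ {U U' X : Curve} (h₁ : IsCofiniteOpen U U') (h₂ : IsCofiniteOpen U' X)
    (h : IsCofiniteOpen U X) (c : (cusps U).Cusp) (hc : cuspPt h₁ c = none),
    cuspPt h c = cuspPt h₂ (cuspRes h₁ c hc)
  /-- (P) for a scheme-like `X` and a closed point `y`, the decomposition group `D_y ≅ G_{k(y)}` meets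
  `Δ_X` trivially (it embeds into `G_k` under `Π_X ↠ G_k`; "the decomposition groups of NF-points",
  Thm. 1.9 (a) p. 37 — points, as opposed to cusps, carry no inertia). -/
  decomp_inf_geom : ∀ (X : Curve), IsScheme X → ∀ y : Point X, decomp X y ⊓ (ext X).geom = ⊥

end Literature.AnabelianGeometry.AbsoluteAnabelian.AbsTopIII
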